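import Literature.Analysis.OperatorTheory.AnalyticFredholm
import Mathlib.Analysis.Normed.Algebra.GelfandFormula
import Mathlib.Analysis.Complex.Convex
import HarnessLib

/-!
# Compact perturbations: the spectrum off the unperturbed spectrum consists of isolated eigenvalues

Analysis/OperatorTheory proofs-layer file (theorems only, no definitions, no named facts).
The **bounded-operator form** of the reasoning "relatively compact perturbations do not disturb
the essential spectrum; hence, in each connected component of the complement of the essential
spectrum, (i) `λ − 𝓛` is not invertible everywhere, or (ii) `λ − 𝓛` is invertible except at
isolated points, which are eigenvalues of finite multiplicity" that Albritton–Brué–Colombo 2022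
use throughout (§2.1 "Spectral preliminaries", citing Kato IV-§5.6 Thm. 5.35 and Engel–Nagel;
applied in Prop. 2.2, Prop. 2.6, Thm. 3.1, Lemma 4.2) and that Jia–Šverák 2015 use for the
linearised similarity operator. For a bounded operator `S` on a complex Hilbert space, a compact
`K`, and an open connected `D ⊆ ρ(S)`:

  `z − (S + K) = (z − S)(1 − R_S(z) K)`   (`algebraMap_sub_add_eq_mul`),

so `z ∈ ρ(S + K) ↔ 1 − R_S(z)K` invertible (`mem_resolventSet_add_iff`), where
`z ↦ R_S(z) K` is analytic (`differentiableOn_resolvent_mul`) and compact-valued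
(`isCompactOperator_resolvent_mul`). The **analytic Fredholm theorem** (Reed–Simon I,
Thm. VI.14; the tree's `analytic_fredholm_holds`) then gives the dichotomy
(`spectrum_add_compact_dichotomy`):

* either `D ⊆ σ(S + K)`,
* or every point of `D` has a punctured neighbourhood in `ρ(S + K)` and every spectral point of
  `S + K` in `D` is an **eigenvalue** (`R_S(z)Kψ = ψ` gives `(S + K)ψ = zψ`),

and the first alternative is excluded as soon as one point of `D` lies in `ρ(S + K)`
(`spectrum_add_compact_isolated_eigenvalues`). This is the input that turns "spectrum inside the
contour" (`RieszProjectionContour.lean`) into "an (unstable) eigenvalue" in the [ABC] arguments.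
The unbounded case used by [ABC] reduces to this one through the resolvent (Kato IV-§5.6,
footnote to Problem 5.38: `Σ_e((T − ζ)⁻¹)` is the image of `Σ_e(T)` under `λ ↦ (λ − ζ)⁻¹`); it
is not treated here. The Hilbert-space setting and universe of the tree's `analytic_fredholm`
(`H : Type`) are kept.

## References

* D. Albritton, E. Brué, M. Colombo, *Non-uniqueness of Leray solutions of the forced
  Navier–Stokes equations*, Ann. of Math. 196 (2022), arXiv:2112.03116, §2.1 (spectral
  preliminaries: dichotomy (i)/(ii), `σ_ess(𝓛 + 𝓣) = σ_ess(𝓛)`, "the spectrum in `{Re λ > μ}`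
  consists of isolated points"). [AlbrittonBrueColombo2022AnnMath]
* M. Reed, B. Simon, *Methods of Modern Mathematical Physics I*, Thm. VI.14 (analytic Fredholm
  theorem) — the tree's `Literature.Analysis.OperatorTheory.analytic_fredholm_holds`. [ReedSimonI1980]
* T. Kato, *Perturbation Theory for Linear Operators* (1966), IV-§5.6, Thm. 5.35 ("The essential
  spectrum is conserved under a relatively compact perturbation"; held copy chunk p0296).
  [Kato1966]
-/

noncomputable section

namespace Literature.Analysis.OperatorTheory

open _root_.Filter _root_.Topology _root_.Set

section Algebra

variable {H : Type*} [NormedAddCommGroup H] [NormedSpace ℂ H]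

/-- **`z − (S + K) = (z − S)(1 − R_S(z)K)`** for `z ∈ ρ(S)` (the factorisation behind every
"relatively compact perturbation" argument; [ABC] §2.1, Jia–Šverák 2015 §2). [cite: AlbrittonBrueColombo2022AnnMath, §2.1] -/
theorem algebraMap_sub_add_eq_mul (S K : H →L[ℂ] H) {z : ℂ} (hz : z ∈ resolventSet ℂ S) :
    algebraMap ℂ (H →L[ℂ] H) z - (S + K) =
      (algebraMap ℂ (H →L[ℂ] H) z - S) * (1 - resolvent S z * K) := by
  have h1 : (algebraMap ℂ (H →L[ℂ] H) z - S) * resolvent S z = 1 := by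
    rw [spectrum.resolvent_eq hz]; exact hz.mul_val_inv
  rw [mul_sub, mul_one, ← mul_assoc, h1, one_mul, sub_add_eq_sub_sub]

/-- **`z ∈ ρ(S + K) ↔ 1 − R_S(z)K` is invertible**, for `z ∈ ρ(S)`. [cite: AlbrittonBrueColombo2022AnnMath, §2.1] -/
theorem mem_resolventSet_add_iff (S K : H →L[ℂ] H) {z : ℂ} (hz : z ∈ resolventSet ℂ S) :
    z ∈ resolventSet ℂ (S + K) ↔ IsUnit (1 - resolvent S z * K) := by
  rw [spectrum.mem_resolventSet_iff, algebraMap_sub_add_eq_mul S K hz, ← hz.unit_spec,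
    Units.isUnit_units_mul]

/-- A fixed vector of `R_S(z)K` is an eigenvector of `S + K` with eigenvalue `z`:
`R_S(z)Kψ = ψ ⟹ (S + K)ψ = zψ` (apply `z − S`). [cite: AlbrittonBrueColombo2022AnnMath, §2.1] -/
theorem apply_eq_smul_of_resolvent_mul_apply_eq (S K : H →L[ℂ] H) {z : ℂ}
    (hz : z ∈ resolventSet ℂ S) {ψ : H} (hψ : (resolvent S z * K) ψ = ψ) :
    (S + K) ψ = z • ψ := by
  have h1 : (algebraMap ℂ (H →L[ℂ] H) z - S) * resolvent S z = 1 := by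
    rw [spectrum.resolvent_eq hz]; exact hz.mul_val_inv
  -- apply `z − S` to `R_S(z) (K ψ) = ψ`
  have h2 : ((algebraMap ℂ (H →L[ℂ] H) z - S) * resolvent S z) (K ψ) =
      (algebraMap ℂ (H →L[ℂ] H) z - S) ψ := by
    rw [mul_apply_eq_comp] at hψ ⊢
    rw [hψ]
  rw [h1, one_apply_eq_self] at h2
  have h3 : (algebraMap ℂ (H →L[ℂ] H) z - S) ψ = z • ψ - S ψ := by
    simp [Algebra.algebraMap_eq_smul_one]
  rw [h3] at h2
  -- `K ψ = z ψ − S ψ`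
  rw [add_apply, h2]
  abel

/-- `z ↦ R_S(z) K` is complex-differentiable on any subset of `ρ(S)`. [folklore] -/
theorem differentiableOn_resolvent_mul [CompleteSpace H] (S K : H →L[ℂ] H) {D : Set ℂ}
    (hD : D ⊆ resolventSet ℂ S) : DifferentiableOn ℂ (fun z => resolvent S z * K) D :=
  fun _ hz => ((spectrum.hasDerivAt_resolvent_const_left (hD hz)).differentiableAt.mul_const
    K).differentiableWithinAt

/-- `R_S(z) K` is compact when `K` is. [folklore] -/
theorem isCompactOperator_resolvent_mul (S : H →L[ℂ] H) {K : H →L[ℂ] H}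
    (hK : IsCompactOperator K) (z : ℂ) : IsCompactOperator (resolvent S z * K) :=
  hK.clm_comp (resolvent S z)

end Algebra

section Dichotomy

variable {H : Type} [NormedAddCommGroup H] [InnerProductSpace ℂ H] [CompleteSpace H]

/-- **Compact perturbations off the unperturbed spectrum: the dichotomy** (bounded-operator form
of [ABC] §2.1 (i)/(ii); proof: analytic Fredholm theorem, Reed–Simon I Thm. VI.14, for
`f(z) = R_S(z)K` on `D`). Let `S, K` be bounded operators on a complex Hilbert space with `K`
compact, and `D` an open connected subset of `ρ(S)`. Then either `D ⊆ σ(S + K)`, or: every point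
of `D` has a punctured neighbourhood contained in `ρ(S + K)` (the spectrum of `S + K` in `D` is a
discrete set), and every `z ∈ D ∩ σ(S + K)` is an eigenvalue of `S + K`.
[cite: AlbrittonBrueColombo2022AnnMath, §2.1 (spectral preliminaries (i)/(ii))] -/
theorem spectrum_add_compact_dichotomy (S K : H →L[ℂ] H) (hK : IsCompactOperator K) {D : Set ℂ}
    (hD : IsOpen D) (hDc : IsConnected D) (hDS : D ⊆ resolventSet ℂ S) :
    (∀ z ∈ D, z ∈ spectrum ℂ (S + K)) ∨
      ((∀ z ∈ D, ∀ᶠ w in 𝓝[≠] z, w ∈ resolventSet ℂ (S + K)) ∧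
        ∀ z ∈ D, z ∈ spectrum ℂ (S + K) → ∃ ψ : H, ψ ≠ 0 ∧ (S + K) ψ = z • ψ) := by
  set f : ℂ → (H →L[ℂ] H) := fun z => resolvent S z * K with hf
  have hAF := analytic_fredholm_holds H D f hD hDc (differentiableOn_resolvent_mul S K hDS)
    fun z _ => isCompactOperator_resolvent_mul S hK z
  rcases hAF with h | ⟨h1, h2⟩
  · left
    intro z hz
    exact spectrum.mem_iff.2 fun hu =>
      h z hz ((mem_resolventSet_add_iff S K (hDS hz)).1 (spectrum.mem_resolventSet_iff.2 hu))
  · right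
    refine ⟨fun z hz => ?_, fun z hz hzσ => ?_⟩
    · have hD' : ∀ᶠ w in 𝓝[≠] z, w ∈ D :=
        eventually_nhdsWithin_of_eventually_nhds (hD.mem_nhds hz)
      filter_upwards [h1 z hz, hD'] with w hw hwD
      exact (mem_resolventSet_add_iff S K (hDS hwD)).2 hw
    · have hnu : ¬ IsUnit (1 - f z) := fun hu =>
        spectrum.mem_iff.1 hzσ
          (spectrum.mem_resolventSet_iff.1 ((mem_resolventSet_add_iff S K (hDS hz)).2 hu))
      obtain ⟨ψ, hψ0, hψ⟩ := h2 z hz hnu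
      exact ⟨ψ, hψ0, apply_eq_smul_of_resolvent_mul_apply_eq S K (hDS hz) hψ⟩

/-- **The spectrum of a compact perturbation is discrete and consists of eigenvalues off the
unperturbed spectrum** ([ABC] §2.1: "we typically know that the perturbed operator is invertible
for `Re λ ≫ 1`. Hence, the spectrum in `{Re λ > μ}` consists of isolated points"): in the
situation of `spectrum_add_compact_dichotomy`, if one point of `D` lies in `ρ(S + K)` then every
point of `D` has a punctured neighbourhood in `ρ(S + K)` and every spectral point of `S + K` in
`D` is an eigenvalue. [cite: AlbrittonBrueColombo2022AnnMath, §2.1 (spectral preliminaries)] -/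
theorem spectrum_add_compact_isolated_eigenvalues (S K : H →L[ℂ] H) (hK : IsCompactOperator K)
    {D : Set ℂ} (hD : IsOpen D) (hDc : IsConnected D) (hDS : D ⊆ resolventSet ℂ S)
    {z₀ : ℂ} (hz₀ : z₀ ∈ D) (hz₀ρ : z₀ ∈ resolventSet ℂ (S + K)) :
    (∀ z ∈ D, ∀ᶠ w in 𝓝[≠] z, w ∈ resolventSet ℂ (S + K)) ∧
      ∀ z ∈ D, z ∈ spectrum ℂ (S + K) → ∃ ψ : H, ψ ≠ 0 ∧ (S + K) ψ = z • ψ := by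
  rcases spectrum_add_compact_dichotomy S K hK hD hDc hDS with h | h
  · exact absurd (spectrum.mem_resolventSet_iff.1 hz₀ρ) (spectrum.mem_iff.1 (h z₀ hz₀))
  · exact h

/-- **Half-plane form** (the way [ABC] §2.1 and Jia–Šverák 2015 use it): if `ρ(S)` contains the
open half-plane `{Re z > μ}` and `S + K` (`K` compact) has a resolvent point there, then the
spectrum of `S + K` in `{Re z > μ}` is a discrete set of eigenvalues.
[cite: AlbrittonBrueColombo2022AnnMath, §2.1 (spectral preliminaries)] -/
theorem spectrum_add_compact_isolated_eigenvalues_halfPlane (S K : H →L[ℂ] H)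
    (hK : IsCompactOperator K) {μ : ℝ} (hS : {z : ℂ | μ < z.re} ⊆ resolventSet ℂ S)
    {z₀ : ℂ} (hz₀ : μ < z₀.re) (hz₀ρ : z₀ ∈ resolventSet ℂ (S + K)) :
    (∀ z : ℂ, μ < z.re → ∀ᶠ w in 𝓝[≠] z, w ∈ resolventSet ℂ (S + K)) ∧
      ∀ z : ℂ, μ < z.re → z ∈ spectrum ℂ (S + K) → ∃ ψ : H, ψ ≠ 0 ∧ (S + K) ψ = z • ψ := by
  have hopen : IsOpen {z : ℂ | μ < z.re} := isOpen_lt continuous_const Complex.continuous_re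
  have hconn : IsConnected {z : ℂ | μ < z.re} := by
    exact ⟨⟨(μ + 1 : ℝ), by simp⟩, (convex_halfSpace_re_gt μ).isPreconnected⟩
  have h := spectrum_add_compact_isolated_eigenvalues S K hK hopen hconn hS hz₀ hz₀ρ
  exact ⟨fun z hz => h.1 z hz, fun z hz => h.2 z hz⟩

end Dichotomy

end Literature.Analysis.OperatorTheory
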